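import Literature.Computability.QuantumComplexity.EvenSVTOutputAccess
import HarnessLib

/-!
# The `u ≈ Rb` step of CGLLTW Theorem 3.4: the matrix–vector product `Rb` by importance sampling
# from `SQ_{φ_b}(b)` (approximate matrix product, Chebyshev form), and its join with the output
# error propagation (CGLLTW 2022, §3.3 proof of Theorem 3.4 with §3.2 Lemma AMP [DKM06])

Chia, Gilyén, Li, Lin, Tang, Wang, J. ACM 69(5):33 (2022) = arXiv:1910.06151, §3.3, proof of
Theorem 3.4 (even case; held arXiv text p. 21 L10–13):

> This reduces the problem to approximating `R†f̄(CC†)Rb + f(0)b`.  We further approximate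
> `Rb ≈ u ∈ ℂ^r` such that `‖Rb − u‖ ≤ ε/d`.  Using (prop:appr-mms), this needs
> `≲ ‖A‖_F²‖b‖²(d²/ε²)(1/δ)` samples … This suffices to maintain the error bound …

`EvenSVTOutputAccess` (`EvenPolySVT.Output.output_error_le`) left this approximation as the free
term `‖RᵀM‖_F·‖u − Rb‖`.  This module types the print's `u`: for ANY `R : s × n` and `SQ_{φ_b}(b)`
(`b ≠ 0`), sample `σ ≥ 1` indices `ω' : Fin σ → Fin n` i.i.d. from `𝒟_{b̃}` and put
`u = (S_{ω'}Rᵀ)ᵀ(S_{ω'}b)`, i.e. `u(t) = (1/σ)Σ_τ R(t,ω'_τ)b(ω'_τ)/𝒟_{b̃}(ω'_τ)` — the tree's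
approximate matrix product `XᵀSᵀSY ≈ XᵀY` (`ApproxMatrixProduct`, DKM06) at `X = Rᵀ`, `Y = b` as an
`n × 1` column:

* `matVecEst`, `matVecEst_eq`, `normSq_matVecEst_sub` — the estimator and
  `‖u − Rb‖² = ‖(SRᵀ)ᵀ(SY) − (Rᵀ)ᵀY‖_F²`;
* **`iid_normSq_matVecEst_sub_le`** — `E_{ω'}‖u − Rb‖² ≤ (φ_b/σ)·‖R‖_F²‖b‖²` (tree
  `iid_frobSq_sub_le'`, sampling from `Y = b`), and the Chebyshev mass form
  **`iid_mass_normSq_matVecEst_sub_ge_le`**: `mass{‖u − Rb‖² ≥ a} ≤ φ_b‖R‖_F²‖b‖²/(σa)` — the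
  print's sample count `σ ≍ φ_b‖R‖_F²‖b‖²/(a·δ)` (there `a = (ε/d)²`, `φ_b = 1`, `‖R‖_F ≲ ‖A‖_F`);
* **`output_error_mass`** — the JOIN with `output_error_le`: for any `M`, `c`, `F`, `η > 0`,
  `δ' > 0`, if `σ ≥ φ_b·‖R‖_F²·‖RᵀM‖_F²/(η²δ')` then
  `mass_{ω'}{‖(RᵀMu + c·b) − Fb‖ ≤ ‖RᵀMR + cI − F‖_F·‖b‖ + η‖b‖} ≥ 1 − δ'` — so on the
  matrix-level event `‖RᵀMR + cI − F‖_F ≤ ε` of `EvenPolySVT.even_polynomial_svt` (a statement about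
  the first two sampling stages, for each of whose outcomes `R`, `M = q̄_clamp(CCᵀ)` the present
  third stage applies with that outcome's `‖R‖_F`, `‖RᵀM‖_F`, exactly as the print sizes its
  sample count by `‖R‖_F`), `‖v − q(AᵀA)b‖ ≤ (ε + η)‖b‖`.

HONEST SCOPE.  Finite weighted sums over `ω' : Fin σ → Fin n` with the i.i.d. product weight
`iidWeight 𝒟_{b̃}` — exactly the `mass` / i.i.d. objects of `ApproxMatrixProduct`, whose variance
bound `iid_frobSq_sub_le'` is used BY NAME (no second engine); Chebyshev `1/δ'`, not a
median-of-means / `log(1/δ)` bound; the threshold is stated PER OUTCOME `(R, M)` of the earlier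
stages, in that outcome's `‖R‖_F`, `‖RᵀM‖_F` — no unconditional three-stage product statement (the
print's sample count is itself sized by `‖R‖_F`); the print's operator-norm bounds
`‖R†√f̄‖·‖√f̄‖ ≲ √2·d`, `‖R‖_F ≲ ‖A‖_F` are NOT typed; `σ` samples of `𝒟_{b̃}` and `σ·s` queries to
`R` are described here, not modelled; nothing on the odd case; no algorithm object.  Nothing here
bears on `BQP` vs `BPP`.  All statements are theorems or explicit data (`colOf`, `matVecEst`); no
named facts; standard axioms.
-/

noncomputable section

open scoped Matrix
open Finset

namespace Literature.Computability.QuantumComplexity.SampleQuery.EvenPolySVT.Output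

variable {n s σ : ℕ}

/-! ### §1 The estimator `u = (SRᵀ)ᵀ(Sb)` -/

/-- `b` as an `n × 1` column matrix: the `Y` of the tree's sketch product `XᵀSᵀSY`
(`ApproxMatrixProduct`) in its `n × 1`-column instance — a thin data def, no new engine.
[cite: ChiaEtAl2022, §3.3 proof of Theorem 3.4 ("Using (prop:appr-mms)")] -/
def colOf (b : Fin n → ℝ) : Matrix (Fin n) (Fin 1) ℝ := fun i _ => b i

/-- `‖Y‖_F² = ‖b‖²` for the column `Y` of `b`. [folklore] -/
private theorem frobSq_colOf (b : Fin n → ℝ) : frobSq (colOf b) = normSq b := by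
  unfold frobSq normSq colOf
  simp

/-- `‖Y(k,·)‖ = |b(k)|`-distribution: an oversampled importance sampling distribution of `b` is one
of the row norms of its column matrix (same squared entries). [folklore] -/
private theorem isOversampledDist_rowNorms_colOf {φb : ℝ} {b : Fin n → ℝ} {p : Fin n → ℝ}
    (h : IsOversampledDist φb b p) : IsOversampledDist φb (rowNorms (colOf b)) p := by
  refine ⟨h.1, h.2.1, fun i => ?_⟩
  have hi := h.2.2 i
  rw [lengthSqDist_rowNorms]
  unfold rowDist
  rw [frobSq_colOf]
  unfold lengthSqDist at hi
  have hrow : normSq (colOf b i) = b i ^ 2 := by unfold normSq colOf; simp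
  rw [hrow]
  exact hi

/-- A `σ × 1` matrix has `‖Z‖_F² = Σ_t Z(t,0)²`. [folklore] -/
private theorem frobSq_col_one (Z : Matrix (Fin s) (Fin 1) ℝ) : frobSq Z = normSq (fun t => Z t 0) := by
  unfold frobSq normSq
  simp

/-- **The matrix–vector estimator** `u = (S_{ω'}Rᵀ)ᵀ(S_{ω'}Y)` read as a vector — the
`n × 1`-column instance (`X = Rᵀ`, `Y = colOf b`) of the tree's sketch product
`(sketch p ω' * X)ᵀ * (sketch p ω' * Y)` of `ApproxMatrixProduct` (`S_{ω'}` the importance-sampling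
sketch of the distribution `p` with `σ` rows); a thin data def, no new engine.
[cite: ChiaEtAl2022, §3.3 proof of Theorem 3.4 ("We further approximate `Rb ≈ u ∈ ℂ^r` … Using
(prop:appr-mms)", held arXiv text p. 21 L10–11); DrineasKannanMahoney2006, §4 (the `CR`
estimator)] -/
def matVecEst (R : Matrix (Fin s) (Fin n) ℝ) (b : Fin n → ℝ) (p : Fin n → ℝ) (ω' : Fin σ → Fin n) :
    Fin s → ℝ :=
  fun t => ((sketch p ω' * Rᵀ)ᵀ * (sketch p ω' * colOf b)) t 0

/-- The estimator written out: `u(t) = Σ_τ R(t,ω'_τ)·b(ω'_τ)/(σ·p(ω'_τ))` (each sampled index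
contributes `R(t,j)b(j)/(σ p(j))`; for `p = 𝒟_b` this is `‖b‖²R(t,j)/(σ b(j))`).
[cite: ChiaEtAl2022, §3.2 (approximate matrix product by importance sampling)] -/
theorem matVecEst_eq {p : Fin n → ℝ} (hp : ∀ k, 0 ≤ p k) (R : Matrix (Fin s) (Fin n) ℝ)
    (b : Fin n → ℝ) (ω' : Fin σ → Fin n) (t : Fin s) :
    matVecEst R b p ω' t = ∑ τ, R t (ω' τ) * b (ω' τ) / (σ * p (ω' τ)) := by
  unfold matVecEst
  rw [sketch_transpose_mul_sketch hp]
  unfold outerEst colOf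
  simp only [Matrix.transpose_apply]
  rw [Finset.sum_div]
  exact sum_congr rfl fun τ _ => by rw [div_div, mul_comm (p (ω' τ))]

/-- **`‖u − Rb‖² = ‖(SRᵀ)ᵀ(SY) − (Rᵀ)ᵀY‖_F²`** — the vector error is the Frobenius error of the
approximate matrix product. [cite: ChiaEtAl2022, §3.3 proof of Theorem 3.4 (`‖Rb − u‖`)] -/
theorem normSq_matVecEst_sub (R : Matrix (Fin s) (Fin n) ℝ) (b : Fin n → ℝ) (p : Fin n → ℝ)
    (ω' : Fin σ → Fin n) :
    normSq (matVecEst R b p ω' - R *ᵥ b) =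
      frobSq ((sketch p ω' * Rᵀ)ᵀ * (sketch p ω' * colOf b) - (Rᵀ)ᵀ * colOf b) := by
  rw [frobSq_col_one]
  unfold normSq matVecEst
  refine sum_congr rfl fun t _ => ?_
  simp only [Pi.sub_apply, Matrix.sub_apply, Matrix.transpose_transpose]
  simp [Matrix.mul_apply, colOf, Matrix.mulVec, dotProduct]

/-! ### §2 Mean-square error and Chebyshev mass (sampling from `SQ_{φ_b}(b)`) -/

/-- **`E_{ω'}‖u − Rb‖² ≤ (φ_b/σ)‖R‖_F²‖b‖²`** for `ω'` i.i.d. from `𝒟_{b̃}`, `b̃` the witness of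
`SQ_{φ_b}(b)`, `b ≠ 0`, `σ ≥ 1` (tree `iid_frobSq_sub_le'`, importance sampling from `Y = b`;
`‖Rᵀ‖_F = ‖R‖_F`). [cite: ChiaEtAl2022, §3.2 Lemma (asymmetric approximate matrix product, [DKM06])
and §3.3 proof of Theorem 3.4 ("this needs `≲ ‖A‖_F²‖b‖²(d²/ε²)(1/δ)` samples");
DrineasKannanMahoney2006, App. A.3 Lemma 8 eq. (47)] -/
theorem iid_normSq_matVecEst_sub_le {φb : ℝ} {b : Fin n → ℝ} (wb : OversamplingWitness φb b)
    (hb : b ≠ 0) (hσ : σ ≠ 0) (R : Matrix (Fin s) (Fin n) ℝ) :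
    ∑ ω' : Fin σ → Fin n, iidWeight (lengthSqDist wb.tilde) ω' *
        normSq (matVecEst R b (lengthSqDist wb.tilde) ω' - R *ᵥ b) ≤
      φb / σ * (frobSq R * normSq b) := by
  have h := iid_frobSq_sub_le' (isOversampledDist_rowNorms_colOf (wb.isOversampledDist hb))
    (wb.pos hb) hσ Rᵀ
  rw [frobSq_transpose, frobSq_colOf] at h
  simpa only [normSq_matVecEst_sub] using h

/-- **Chebyshev form: `mass_{ω'}{‖u − Rb‖² ≥ a} ≤ φ_b‖R‖_F²‖b‖²/(σ·a)`** (`a > 0`) — the print's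
sample count `σ ≍ φ_b‖R‖_F²‖b‖²/(a·δ)` for failure probability `δ` (there `a = (ε/d)²`).
[cite: ChiaEtAl2022, §3.3 proof of Theorem 3.4 ("`≲ ‖A‖_F²‖b‖²(d²/ε²)(1/δ)` samples", held arXiv
text p. 21 L11) with §3.2 ("together with Chebyshev's inequality")] -/
theorem iid_mass_normSq_matVecEst_sub_ge_le {φb : ℝ} {b : Fin n → ℝ} (wb : OversamplingWitness φb b)
    (hb : b ≠ 0) (hσ : σ ≠ 0) (R : Matrix (Fin s) (Fin n) ℝ) {a : ℝ} (ha : 0 < a) :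
    ∑ ω' ∈ univ.filter (fun ω' : Fin σ → Fin n =>
        a ≤ normSq (matVecEst R b (lengthSqDist wb.tilde) ω' - R *ᵥ b)),
        iidWeight (lengthSqDist wb.tilde) ω' ≤
      φb / σ * (frobSq R * normSq b) / a := by
  rw [le_div_iff₀ ha, mul_comm]
  exact (mul_sum_filter_le_sum_mul _ _ (iidWeight_nonneg (wb.isOversampledDist hb).nonneg)
    (fun ω' => normSq_nonneg _) a).trans (iid_normSq_matVecEst_sub_le wb hb hσ R)

/-! ### §3 The join with the output error propagation -/

/-- Complement of a Chebyshev event under a probability weight: if the weights are nonnegative,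
sum to `1`, and the "bad" mass is `≤ δ'`, the "good" mass is `≥ 1 − δ'`. [folklore] -/
private theorem mass_compl_ge {ι : Type*} [Fintype ι] (w : ι → ℝ) (hw1 : ∑ i, w i = 1)
    (P Q : ι → Prop) [DecidablePred P] [DecidablePred Q] (hPQ : ∀ i, ¬ Q i → P i) {δ' : ℝ}
    (hQ : ∑ i ∈ univ.filter Q, w i ≤ δ') (hw : ∀ i, 0 ≤ w i) :
    1 - δ' ≤ ∑ i ∈ univ.filter P, w i := by
  have hsplit : ∑ i ∈ univ.filter (fun i => ¬ Q i), w i = 1 - ∑ i ∈ univ.filter Q, w i := by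
    rw [← hw1, ← sum_filter_add_sum_filter_not univ Q]
    ring
  calc 1 - δ' ≤ 1 - ∑ i ∈ univ.filter Q, w i := by linarith
    _ = ∑ i ∈ univ.filter (fun i => ¬ Q i), w i := hsplit.symm
    _ ≤ ∑ i ∈ univ.filter P, w i :=
        sum_le_sum_of_subset_of_nonneg (fun i hi => by
          rw [mem_filter] at hi ⊢; exact ⟨hi.1, hPQ i hi.2⟩) (fun i _ _ => hw i)

/-- **The `u ≈ Rb` step joined to the output error (CGLLTW Thm 3.4, even case, vector step).**
For ANY `R : s × n`, `M : s × s`, scalar `c`, target `F`, `SQ_{φ_b}(b)` with `b ≠ 0`, accuracy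
`η > 0` and failure budget `δ' > 0`: if the number of importance samples from `𝒟_{b̃}` satisfies
**`σ ≥ φ_b·‖R‖_F²·‖RᵀM‖_F²/(η²·δ')`** (and `σ ≥ 1`), then with `u = matVecEst R b 𝒟_{b̃} ω'`,
`mass_{ω'}{ ‖(RᵀMu + c·b) − Fb‖ ≤ ‖RᵀMR + cI − F‖_F·‖b‖ + η·‖b‖ } ≥ 1 − δ'`
(`output_error_le` + Chebyshev at `a = η²‖b‖²/‖RᵀM‖_F²`; if `RᵀM = 0` the event is sure).  On
the matrix-level event `‖RᵀMR + cI − F‖_F ≤ ε` of `EvenPolySVT.even_polynomial_svt` (for each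
outcome `R = S_ωA`, `M = q̄_clamp(CCᵀ)`, `c = q(0)`, `F = q(AᵀA)` of its two stages) this reads
`‖v − q(AᵀA)b‖ ≤ (ε + η)‖b‖`; the print takes `η ≍ ε` and bounds `‖RᵀM‖_F` via
`‖R†√f̄‖·‖√f̄‖ ≲ √2·d`, `‖R‖_F ≲ ‖A‖_F`, whence its `σ ≍ ‖A‖_F²‖b‖²d²/(ε²δ)` (after its rescaling
`ε ← ε‖b‖`-type normalisation); those operator-norm bounds are not typed here.
[cite: ChiaEtAl2022, §3.3 proof of Theorem 3.4 ("We further approximate `Rb ≈ u` … This suffices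
to maintain the error bound because `‖R†f̄(CC†)(Rb − u)‖ ≤ … ≲ ε`", held arXiv text p. 21
L10–13)] -/
theorem output_error_mass {φb : ℝ} {b : Fin n → ℝ} (wb : OversamplingWitness φb b) (hb : b ≠ 0)
    (hσ : 0 < σ) (R : Matrix (Fin s) (Fin n) ℝ) (M : Matrix (Fin s) (Fin s) ℝ)
    (F : Matrix (Fin n) (Fin n) ℝ) (c : ℝ) {η δ' : ℝ} (hη : 0 < η) (hδ' : 0 < δ')
    (hσL : φb * frobSq R * frobSq (Rᵀ * M) / (η ^ 2 * δ') ≤ σ) :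
    1 - δ' ≤
      ∑ ω' ∈ univ.filter (fun ω' : Fin σ → Fin n =>
          Real.sqrt (normSq (Rᵀ *ᵥ (M *ᵥ matVecEst R b (lengthSqDist wb.tilde) ω') + c • b -
              F *ᵥ b)) ≤
            Real.sqrt (frobSq (Rᵀ * M * R + c • (1 : Matrix (Fin n) (Fin n) ℝ) - F)) *
                Real.sqrt (normSq b) +
              η * Real.sqrt (normSq b)),
        iidWeight (lengthSqDist wb.tilde) ω' := by
  classical
  set p := lengthSqDist wb.tilde with hp
  have hdist := wb.isOversampledDist hb
  have hw1 : ∑ ω' : Fin σ → Fin n, iidWeight p ω' = 1 := sum_iidWeight hdist.sum_eq_one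
  have hw0 : ∀ ω' : Fin σ → Fin n, 0 ≤ iidWeight p ω' := iidWeight_nonneg hdist.nonneg
  have hbpos : 0 < normSq b := normSq_pos hb
  -- the case `RᵀM = 0`: the second error term vanishes, the event is sure
  rcases eq_or_ne (frobSq (Rᵀ * M)) 0 with h0 | h0
  · have hRM : Rᵀ * M = 0 := by
      by_contra hne
      exact (frobSq_pos hne).ne' h0
    refine (mass_compl_ge _ hw1 _ (fun _ => False) (fun ω' _ => ?_) (by simp [hδ'.le]) hw0)
    calc Real.sqrt (normSq (Rᵀ *ᵥ (M *ᵥ matVecEst R b p ω') + c • b - F *ᵥ b))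
        ≤ _ := output_error_le R M F _ c b
      _ ≤ _ := by
          rw [hRM]
          have : Real.sqrt (frobSq (0 : Matrix (Fin n) (Fin s) ℝ)) = 0 := by
            rw [show frobSq (0 : Matrix (Fin n) (Fin s) ℝ) = 0 from by unfold frobSq normSq; simp,
              Real.sqrt_zero]
          rw [this, zero_mul, add_zero]
          exact le_add_of_nonneg_right (by positivity)
  -- the main case: Chebyshev at `a = η²‖b‖²/‖RᵀM‖_F²`
  have hRMpos : 0 < frobSq (Rᵀ * M) := lt_of_le_of_ne (frobSq_nonneg _) (Ne.symm h0)
  set a : ℝ := η ^ 2 * normSq b / frobSq (Rᵀ * M) with ha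
  have hapos : 0 < a := by positivity
  have hσ0 : σ ≠ 0 := Nat.pos_iff_ne_zero.mp hσ
  have hmass := iid_mass_normSq_matVecEst_sub_ge_le wb hb hσ0 R hapos
  -- the Chebyshev mass is ≤ δ' under the threshold
  have hbad : ∑ ω' ∈ univ.filter (fun ω' : Fin σ → Fin n =>
      a ≤ normSq (matVecEst R b p ω' - R *ᵥ b)), iidWeight p ω' ≤ δ' := by
    refine hmass.trans ?_
    rw [ha, div_div_eq_mul_div, div_le_iff₀ (by positivity)]
    have hσ' : (0 : ℝ) < σ := by exact_mod_cast hσ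
    have h1 : φb * frobSq R * frobSq (Rᵀ * M) ≤ σ * (η ^ 2 * δ') := by
      rwa [div_le_iff₀ (by positivity)] at hσL
    -- φb/σ·(‖R‖_F²‖b‖²)·‖RᵀM‖_F² ≤ δ'·(η²‖b‖²)
    rw [div_mul_eq_mul_div, div_mul_eq_mul_div, div_le_iff₀ hσ']
    nlinarith [hbpos, hRMpos]
  refine mass_compl_ge _ hw1 _ _ (fun ω' hgood => ?_) hbad hw0
  -- on the good event `‖u − Rb‖² < a`: `‖RᵀM‖_F·‖u − Rb‖ ≤ η‖b‖`
  have hlt : normSq (matVecEst R b p ω' - R *ᵥ b) < a := not_le.mp hgood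
  have hterm : Real.sqrt (frobSq (Rᵀ * M)) *
      Real.sqrt (normSq (matVecEst R b p ω' - R *ᵥ b)) ≤ η * Real.sqrt (normSq b) := by
    rw [← Real.sqrt_mul (frobSq_nonneg _), show η * Real.sqrt (normSq b) =
      Real.sqrt (η ^ 2 * normSq b) by
        rw [Real.sqrt_mul (sq_nonneg _), Real.sqrt_sq hη.le]]
    refine Real.sqrt_le_sqrt ?_
    have : frobSq (Rᵀ * M) * a = η ^ 2 * normSq b := by
      rw [ha, mul_div_cancel₀ _ h0] 
    calc frobSq (Rᵀ * M) * normSq (matVecEst R b p ω' - R *ᵥ b)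
        ≤ frobSq (Rᵀ * M) * a := mul_le_mul_of_nonneg_left hlt.le (frobSq_nonneg _)
      _ = η ^ 2 * normSq b := this
  exact (output_error_le R M F _ c b).trans (add_le_add le_rfl hterm)

end Literature.Computability.QuantumComplexity.SampleQuery.EvenPolySVT.Output
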